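import Summits.FinalStateConjecture.FinalStateConjecture.Theses.StarvedNecks
import Summits.FinalStateConjecture.FinalStateConjecture.Theorems.StarvedNecksNecksCertifyStubConeSeparation

/-!
# Route StarvedNecks — crux `GapDecaySuffices` (stmt-FinalStateConjecture-18060), line `Sketch`:
# location bricks `stub_flatTimeGe`, `stub_collarLateFlat`

Two registered bricks of the lead's skeleton `Cruxes/GapDecaySuffices/Lines/Sketch.lean` (wave-1 worker
on stub S4; the v1 statement of S4 was reshaped after this worker's counterexample — a staircase
majorant read at two clocks — see the skeleton's docstring of `AnchoredLocation`):

* `stub_flatTimeGe` — lower Lorentz clock bound on a boosted Kerr background with motion `(Λ, c)`: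
  `c⁰ + γ·t(y) − √(γ² − 1)(r(y) + |a|) ≤ y⁰`, `γ = (Λ∂₀)⁰` (from the landed `abs_flatTime_sub_le`).
* `stub_collarLateFlat` — the first half of S4's conclusion: for an orthochronous decomposition with pairwise
  distinct velocities, a hole `i` and a monotone sublinear profile `ρ' ≥ 1` with `ρᵢ + 1 ≤ a₀ρ'`
  eventually, every late enough collar point `a₀ρ'(y⁰) ≤ rᵢ y ≤ Aρ'(y⁰)`, `tᵢ y > τ₂`, lies in the flat
  domain with `τ₀ < y⁰` and clears every excised tube with margin `1` (cone separation p106992, the clock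
  bound, sublinearity of `ρ'` and of the excision radii).

Mathlib + landed `…Cones.stub_coneSeparation`, `…Seam.abs_flatTime_sub_le`; no definitions, no named
facts.  References: DHRT arXiv:2104.08222 §1; O'Neill 1983, Ch. 9 (Lorentz kinematics).
-/

noncomputable section

open scoped Manifold ContDiff Topology ENNReal
open Filter Set Topology Literature.Geometry.Lorentzian

namespace Summit.FinalStateConjecture.FinalStateConjecture.Theorems.GapDecaySuffices.Location

set_option linter.dupNamespace false

open Summit.FinalStateConjecture.FinalStateConjecture.Theorems.NecksCertifyBargmann.Seam
  (abs_flatTime_sub_le)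
open Summit.FinalStateConjecture.FinalStateConjecture.Theorems.NecksCertifyTwoCap.Cones
  (stub_coneSeparation)

/-- **Registered brick `stub_flatTimeGe`.**  Lower Lorentz clock bound on a boosted Kerr background with
motion `(Λ, c)`: `c⁰ + γ·t(y) − √(γ² − 1)(r(y) + |a|) ≤ y⁰`, `γ = (Λ∂₀)⁰` (from `abs_flatTime_sub_le`;
O'Neill 1983, Ch. 9). [folklore] -/
theorem stub_flatTimeGe (Λ : lorentzGroup) (c : E4) (M a : ℝ) (y : E4) :
    c 0 + ((Λ : E4 ≃L[ℝ] E4) (E4.basisVector 0)) 0 * (boostedKerrBackground Λ c M a).time y -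
      Real.sqrt ((((Λ : E4 ≃L[ℝ] E4) (E4.basisVector 0)) 0) ^ 2 - 1) *
        ((boostedKerrBackground Λ c M a).radius y + |a|) ≤ y 0 := by
  have h := abs_flatTime_sub_le Λ c M a y
  rw [abs_le] at h
  linarith [h.1]

/-- **Late collars are late-flat** (first half of the conclusion of `AnchoredLocation`).  For a
final-state decomposition with orthochronous, pairwise distinct asymptotic velocities, a hole `i`,
a monotone sublinear profile `ρ' ≥ 1` with `ρᵢ + 1 ≤ a₀ρ'` eventually, and any `A`: after some hole
time `τ₂ ≥ τ₁`, every coordinate point `y` with `τ₂ < tᵢ y` and `a₀ρ'(y⁰) ≤ rᵢ y ≤ Aρ'(y⁰)` lies in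
the flat domain with `τ₀ < y⁰` and clears every excised tube with margin `1`.  Proof: the clock
bound forces `y⁰ → ∞` with `tᵢ y` on the collar; then cone separation (`rᵢ ≤ c y⁰ ⇒ c y⁰ < rⱼ`)
and sublinearity of `ρ'`, `ρⱼ`. -/
theorem stub_collarLateFlat {𝓢 : Spacetime.{0} 4} {O : Set 𝓢.carrier} {k : ℕ}
    (d : FinalStateDecomposition 𝓢 O k)
    (horth : ∀ j, 0 < ((d.motion j).1 : E4 ≃L[ℝ] E4) (E4.basisVector 0) 0)
    (hdv : ∀ i j : Fin d.N, i ≠ j →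
      ((d.motion i).1 : E4 ≃L[ℝ] E4) (E4.basisVector 0) ≠
        ((d.motion j).1 : E4 ≃L[ℝ] E4) (E4.basisVector 0))
    (i : Fin d.N) {ρ' : ℝ → ℝ} (hmono : Monotone ρ') (hone : ∀ s, 1 ≤ ρ' s)
    (hsub : Tendsto (fun s ↦ ρ' s / s) atTop (𝓝 0)) (a₀ A : ℝ)
    (hexc : ∀ᶠ s in atTop, d.excision i s + 1 ≤ a₀ * ρ' s) (τ₁ : ℝ) :
    ∃ τ₂ : ℝ, τ₁ ≤ τ₂ ∧ ∀ y : E4, τ₂ < (d.background i).time y →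
      a₀ * ρ' (y 0) ≤ (d.background i).radius y → (d.background i).radius y ≤ A * ρ' (y 0) →
      y ∈ d.flatDomain ∧ d.τ₀ < y 0 ∧ ∀ j, d.excision j (y 0) + 1 ≤ (d.background j).radius y := by
  obtain ⟨c, hc, τc, hcone⟩ := stub_coneSeparation 𝓢 O k d horth hdv
  -- eventual facts in the coordinate time `s`
  have hE2 : ∀ᶠ s in atTop, ∀ j, d.excision j s + 1 ≤ c * s := by
    refine Filter.eventually_all.2 fun j ↦ ?_
    have h1 : ∀ᶠ s in atTop, d.excision j s / s < c / 2 :=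
      (d.tendsto_excision_div j).eventually (gt_mem_nhds (by positivity))
    filter_upwards [h1, eventually_gt_atTop (0 : ℝ), eventually_ge_atTop (2 / c)] with s hs hs0 hs2
    rw [div_lt_iff₀ hs0] at hs
    rw [div_le_iff₀' hc] at hs2
    linarith
  have hE3 : ∀ᶠ s in atTop, (max A 0 + 1) * ρ' s < c * s := by
    have hpos : 0 < max A 0 + 1 := by positivity
    have h1 : ∀ᶠ s in atTop, ρ' s / s < c / (max A 0 + 1) :=
      hsub.eventually (gt_mem_nhds (by positivity))
    filter_upwards [h1, eventually_gt_atTop (0 : ℝ)] with s hs hs0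
    rw [div_lt_iff₀ hs0, div_mul_eq_mul_div, lt_div_iff₀ hpos] at hs
    linarith
  obtain ⟨T, hT⟩ := Filter.eventually_atTop.1
    (hexc.and (hE2.and (hE3.and ((eventually_ge_atTop τc).and (eventually_gt_atTop d.τ₀)))))
  -- the clock constants of hole `i`
  obtain ⟨γ, hγ⟩ : ∃ γ : ℝ, γ = (((d.motion i).1 : E4 ≃L[ℝ] E4) (E4.basisVector 0)) 0 := ⟨_, rfl⟩
  have hγ0 : 0 < γ := hγ ▸ horth i
  obtain ⟨S, hS⟩ : ∃ S : ℝ, S = Real.sqrt (γ ^ 2 - 1) * (max A 0 * ρ' T + |d.spin i|) := ⟨_, rfl⟩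
  refine ⟨max τ₁ ((T - (d.motion i).2 0 + S) / γ), le_max_left _ _, fun y hty hlo hhi ↦ ?_⟩
  have hclock : (d.motion i).2 0 + γ * (d.background i).time y -
      Real.sqrt (γ ^ 2 - 1) * ((d.background i).radius y + |d.spin i|) ≤ y 0 := by
    have h := stub_flatTimeGe (d.motion i).1 (d.motion i).2 (d.mass i) (d.spin i) y
    rw [← hγ] at h
    exact h
  -- the coordinate time of a late collar point is late
  have hT' : T ≤ y 0 := by
    by_contra hlt
    rw [not_le] at hlt
    have h1 : ρ' (y 0) ≤ ρ' T := hmono hlt.le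
    have h2 : (d.background i).radius y ≤ max A 0 * ρ' T :=
      calc (d.background i).radius y ≤ A * ρ' (y 0) := hhi
        _ ≤ max A 0 * ρ' (y 0) :=
          mul_le_mul_of_nonneg_right (le_max_left _ _) (by linarith [hone (y 0)])
        _ ≤ max A 0 * ρ' T := mul_le_mul_of_nonneg_left h1 (le_max_right _ _)
    have h3 : Real.sqrt (γ ^ 2 - 1) * ((d.background i).radius y + |d.spin i|) ≤ S := by
      rw [hS]
      exact mul_le_mul_of_nonneg_left (by linarith) (Real.sqrt_nonneg _)
    have h4 : (T - (d.motion i).2 0 + S) / γ < (d.background i).time y :=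
      lt_of_le_of_lt (le_max_right _ _) hty
    rw [div_lt_iff₀ hγ0] at h4
    linarith
  obtain ⟨hx1, hx2, hx3, hx4, hx5⟩ := hT (y 0) hT'
  have hri : (d.background i).radius y ≤ c * y 0 := by
    have : A * ρ' (y 0) ≤ (max A 0 + 1) * ρ' (y 0) :=
      mul_le_mul_of_nonneg_right (by linarith [le_max_left A 0]) (by linarith [hone (y 0)])
    linarith
  have hall : ∀ j, d.excision j (y 0) + 1 ≤ (d.background j).radius y := by
    intro j
    rcases eq_or_ne j i with rfl | hij
    · linarith
    · have := hcone i j y (Ne.symm hij) hx4 hri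
      linarith [hx2 j]
  refine ⟨d.setOf_lt_excision_subset_flatDomain ⟨hx5, fun j ↦ ?_⟩, hx5, hall⟩
  show d.excision j (y 0) < (d.background j).radius y
  linarith [hall j]

end Summit.FinalStateConjecture.FinalStateConjecture.Theorems.GapDecaySuffices.Location

end
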